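import Literature.MathematicalPhysics.QuantumLattice.InfVolFermionStateDensity
import HarnessLib

/-!
# Passage to the thermodynamic limit for certified energy bounds of the 2D Hubbard model

Family `hubbard` (trunk T-QLATTICE). The closing step of a thermodynamic-limit bootstrap bound
(X. Han, arXiv:2006.06002 (2020), §2–3: "the bootstrap works directly in the thermodynamic limit"):
one translation-invariant dual certificate, evaluated on EVERY large torus `(ℤ/Lℤ)²` (where its
finitely many local operators fit without wrapping and the tracial sector ground state is a feasible
point), yields `c + μ (N_L(n)/L² − n) ≤ E_{L×L}(N_L(n))/L²` for all large `L`, the density being fixed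
by a Lagrange multiplier `μ` and `N_L(n) = rectN n L = 2⌊nL²/2⌋`; since `N_L(n)/L² → n`
(`tendsto_rectN_div_sq`, tree, `InfVolFermionStateDensity`) and `E_{L×L}(N_L(n))/L² → e(t,U,n)`
(`tendsto_energyDensity2D`, tree), the
certified constant bounds the thermodynamic-limit energy density `energyDensity2D t U n` from below
(`energyDensity2D_ge_of_eventually_ge`; square-torus form `energyDensity2D_ge_of_eventually_ge_torus`).
The symmetric statement for upper bounds (variational trial states on every large torus) is
`energyDensity2D_le_of_eventually_le`. Everything is PROVED; no named fact is introduced; the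
finite-`L` inequality is the hypothesis a certificate discharges (via
`Literature.MathematicalPhysics.QuantumLattice.groundEnergyAt_ge_of_certificate` /
`Matrix.minEnergyOn_ge_of_symmetric_certificate`).

## References
* X. Han, *Quantum many-body bootstrap*, arXiv:2006.06002 (2020), §2–3. [cite: Han2020Bootstrap, §2]
* D. Ruelle, *Statistical Mechanics* (1969), §3.3 (thermodynamic limit of the ground-state energy
  density; tree `tendsto_energyDensity2D`). [cite: Ruelle1969, §3.3]
-/

noncomputable section

namespace Literature.MathematicalPhysics.QuantumLattice

namespace ThermodynamicLimit

open Filter _root_.Topology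

/-- **Certified lower bounds pass to the thermodynamic limit.** If for all large `L`
`c + μ (N_L(n)/L² − n) ≤ E_{L×L}(N_L(n))/L²` (`U ≥ 0`, `0 ≤ n < 2`), then `c ≤ e(t,U,n)`.
Han (2020) §2–3 (bootstrap "directly in the thermodynamic limit"), read through the tree's
`tendsto_energyDensity2D`. [cite: Han2020Bootstrap, §3] -/
theorem energyDensity2D_ge_of_eventually_ge (t : ℝ) {U : ℝ} (hU : 0 ≤ U) {n : ℝ} (hn0 : 0 ≤ n)
    (hn2 : n < 2) {c μ : ℝ}
    (h : ∀ᶠ L : ℕ in atTop, c + μ * ((rectN n L : ℝ) / (L : ℝ) ^ 2 - n) ≤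
      groundEnergyAt (fermionRectTorusGraph L L) t U (rectN n L) / (L : ℝ) ^ 2) :
    c ≤ energyDensity2D t U n := by
  have hl : Tendsto (fun L : ℕ => c + μ * ((rectN n L : ℝ) / (L : ℝ) ^ 2 - n)) atTop (𝓝 c) := by
    have h1 := ((tendsto_rectN_div_sq hn0).sub_const n).const_mul μ |>.const_add c
    simpa using h1
  exact le_of_tendsto_of_tendsto hl (tendsto_energyDensity2D t hU hn0 hn2) h

/-- The same along the square tori `fermionTorusGraph 2 L` of the tree (`E_{torus L} = E_{L×L}`).
[cite: Han2020Bootstrap, §3] -/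
theorem energyDensity2D_ge_of_eventually_ge_torus (t : ℝ) {U : ℝ} (hU : 0 ≤ U) {n : ℝ}
    (hn0 : 0 ≤ n) (hn2 : n < 2) {c μ : ℝ}
    (h : ∀ᶠ L : ℕ in atTop, c + μ * ((rectN n L : ℝ) / (L : ℝ) ^ 2 - n) ≤
      groundEnergyAt (fermionTorusGraph 2 L) t U (rectN n L) / (L : ℝ) ^ 2) :
    c ≤ energyDensity2D t U n := by
  refine energyDensity2D_ge_of_eventually_ge t hU hn0 hn2 (μ := μ) ?_
  filter_upwards [h] with L hL
  rwa [groundEnergyAt_fermionTorusGraph_two] at hL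

/-- **Certified upper bounds pass to the thermodynamic limit**: if for all large `L`
`E_{L×L}(N_L(n))/L² ≤ c + μ (N_L(n)/L² − n)` (e.g. exact Rayleigh quotients of translation-covariant
trial states), then `e(t,U,n) ≤ c`. [cite: Ruelle1969, §3.3] -/
theorem energyDensity2D_le_of_eventually_le (t : ℝ) {U : ℝ} (hU : 0 ≤ U) {n : ℝ} (hn0 : 0 ≤ n)
    (hn2 : n < 2) {c μ : ℝ}
    (h : ∀ᶠ L : ℕ in atTop, groundEnergyAt (fermionRectTorusGraph L L) t U (rectN n L) / (L : ℝ) ^ 2 ≤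
      c + μ * ((rectN n L : ℝ) / (L : ℝ) ^ 2 - n)) :
    energyDensity2D t U n ≤ c := by
  have hl : Tendsto (fun L : ℕ => c + μ * ((rectN n L : ℝ) / (L : ℝ) ^ 2 - n)) atTop (𝓝 c) := by
    have h1 := ((tendsto_rectN_div_sq hn0).sub_const n).const_mul μ |>.const_add c
    simpa using h1
  exact le_of_tendsto_of_tendsto (tendsto_energyDensity2D t hU hn0 hn2) hl h

end ThermodynamicLimit

end Literature.MathematicalPhysics.QuantumLattice
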